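import Summits.Parity.GeneralizedHardyLittlewood.Theorems.LeeYangFibresRelativeDimOneMoebiusSplitDefs
import Summits.Parity.GeneralizedHardyLittlewood.Theorems.LeeYangFibresRelativeDimOneMoebiusSplitStubDefs
import Summits.Parity.GeneralizedHardyLittlewood.Theorems.LeeYangFibresRelativeDimOneMoebiusSplitLatticeCount
import Summits.Parity.GeneralizedHardyLittlewood.Theorems.LeeYangFibresRelativeDimOneMoebiusSplitAssembly
import Summits.Parity.GeneralizedHardyLittlewood.Theorems.LeeYangFibresRelativeDimOneMoebiusSplitTSSInduction
import Summits.Parity.GeneralizedHardyLittlewood.Theorems.LeeYangFibresRelativeDimOneMoebiusSplitTSSLocalData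
import Summits.Parity.GeneralizedHardyLittlewood.Theorems.LeeYangFibresRelativeDimOneMoebiusSplitTSSCompose
import Summits.Parity.GeneralizedHardyLittlewood.Theorems.LeeYangFibresRelativeDimOneMoebiusSplitMoebiusTermBV
import Summits.Parity.GeneralizedHardyLittlewood.Theorems.LeeYangFibresRelativeDimOneMoebiusSplitTermExpansion
import Summits.Parity.GeneralizedHardyLittlewood.Theorems.LeeYangFibresRelativeDimOneMoebiusSplitTermClassSums
import Summits.Parity.GeneralizedHardyLittlewood.Theorems.LeeYangFibresAbsoluteUpgradeSlices
import Literature.NumberTheory.Sieve.LinearEquationsInPrimesSingularSeries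
import HarnessLib

/-!
# Line `single-moebius-split` — crux `RelativeDimOne` (stmt-Parity-14113) — LEAD SKELETON (c7, reshaped)

Crux (route `LeeYangFibres`, rank 9, the route's `d = 1` OUTPUT node):
`Summit.Parity.GeneralizedHardyLittlewood.Theses.LeeYangFibres.RelativeDimOne`.

Reshape of the crux-strategist skeleton `Lines/single_moebius_split.lean` (4 stubs T1, T0', S, H) into
registered stubs with the same composition idea (lead `prover-line-stmt-Parity-14113-c7-0`; six in cycle 1,
reshaped to seven live + two landed in cycle 2, vocabulary `…MoebiusSplitDefs` + `…MoebiusSplitStubDefs`):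
* `stub_truncLatticeCount`  (T1a, L)   `∀ k, TruncLatticeCount (k+1)` — CRT / volume packing — LANDED p139091;
* T1b `∀ k, TruncSingularSeriesAsymp (k+1)` (multivariate GY Lemma 2.1) — RESHAPED (cycle 2) into
  `stub_tssInduction` (A, XL: general-data induction), `stub_tssLocalData` (B, M: CRT), `stub_tssCompose` (C, L);
* `stub_moebiusTermBV`      (T0', XL)  `∀ k, MoebiusTermBound k` — Bombieri–Vinogradov for `μ` (verbatim);
* S1 term `j ≥ 1` ⟸ atom `H_j` — RESHAPED (cycle 2) into `stub_termExpansion` (D, M: class-sum expansion)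
  and `stub_termClassSums` (E, XL: class sums ⟸ atom), composed in-file (`termBound_of`);
* `stub_assembly`           (S2, M)    telescoping + T1 + T0' + S1 ⟹ the `(k+1)`-slice — LANDED p138577;
* `stub_hybrid`             (H, open)  the single-Möbius hybrid HL–Chowla atom (verbatim).
Real proofs: `truncatedMainTerm_of` (T1a → T1b → T1, `β_∞ ≤ 2N`), `relativeDimOne_modulo_stubs`
(the crux BY NAME modulo exactly the six stubs), `RelativeDimOne_of` (hypothesis form, no sorry in its
cone), `slice_one_of_mainTerms` (`k = 0`: no atom consumed), sanity lemmas.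

VOCABULARY: the route Defs file `Theorems/LeeYangFibresRelativeDimOneMoebiusSplitDefs.lean` (p137805,
ACCEPTED 2026-08-17T02:10Z), imported.

Honours Disproof.lean (cdisprove c1, NO KILL, Targets: none): A1 size, A2 box, A3 convexity, A4 both
clauses (the atom demands non-degeneracy of the WHOLE `(φ₀; φ₁..φ_s)`), B1/B1′ (every bound keeps an
absolute slack), B2 (`∃ Y₀` after `∀ L` in the atom), C (`t = 1` slice = T1(1) + T0'(0), a theorem).
-/

noncomputable section

open scoped BigOperators Classical
open Filter Finset Literature.NumberTheory.Sieve
open Summit.Parity.GeneralizedHardyLittlewood.Theses.LeeYangFibres (RelativeDimOne)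
open Summit.Parity.GeneralizedHardyLittlewood.Theorems.AbsoluteUpgrade (archFactor_le_two_mul)

namespace Summit.Parity.GeneralizedHardyLittlewood.Cruxes.RelativeDimOne.SingleMoebiusSplit



/-! ## Registered stubs -/

-- **T1a — LANDED** (p139091, `…Theorems.LeeYangFibresRelativeDimOneMoebiusSplitLatticeCount`):
-- `stub_truncLatticeCount : ∀ k : ℕ, TruncLatticeCount (k + 1)` (imported, used by name below).

-- **T1b-A — LANDED** (p147673, `…Theorems.LeeYangFibresRelativeDimOneMoebiusSplitTSSInduction`):
-- `stub_tssInduction : ∀ t : ℕ, TSSInduction t` (imported, used by name in `truncSingularSeries_of`).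

-- **T1b-B — LANDED** (p149169, `…Theorems.LeeYangFibresRelativeDimOneMoebiusSplitTSSLocalData`):
-- `stub_tssLocalData : ∀ t : ℕ, TSSLocalData t`.

-- **T1b-C — LANDED** (p151735, `…Theorems.LeeYangFibresRelativeDimOneMoebiusSplitTSSCompose`):
-- `stub_tssCompose : (∀ t, TSSInduction t) → (∀ t, TSSLocalData t) → ∀ k, TruncSingularSeriesAsymp (k + 1)`.

/-- **T1b = T1b-C(T1b-A, T1b-B)**: the truncated singular series is asymptotic to `𝔖(Ψ)` uniformly along
staggered levels. -/
theorem truncSingularSeries_of : ∀ k : ℕ, TruncSingularSeriesAsymp (k + 1) :=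
  stub_tssCompose stub_tssInduction stub_tssLocalData

-- **T0' — LANDED** (p151428, `…Theorems.LeeYangFibresRelativeDimOneMoebiusSplitMoebiusTermBV`):
-- `stub_moebiusTermBV : ∀ k : ℕ, MoebiusTermBound k`.

-- **S1-D — LANDED** (p151427, `…Theorems.LeeYangFibresRelativeDimOneMoebiusSplitTermExpansion`):
-- `stub_termExpansion : ∀ (k : ℕ) (j : Fin (k + 1)), j ≠ 0 → TermExpansionBound k j`.

-- **S1-E — LANDED** (p153308, `…Theorems.LeeYangFibresRelativeDimOneMoebiusSplitTermClassSums`):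
-- `stub_termClassSums : ∀ k j, j ≠ 0 → ∀ η, 0 < η → (∀ C A, HybridOneMoebius (j : ℕ) η C A) → TermClassSumBound k j η`.

/-- `N^{1/2} ≤ (ε/2) N` for `N ≥ 4/ε²`. -/
theorem rpow_half_le_eps_mul {ε : ℝ} (hε : 0 < ε) {N : ℕ} (hN : 4 / ε ^ 2 ≤ (N : ℝ)) :
    (N : ℝ) ^ (1 / 2 : ℝ) ≤ ε / 2 * N := by
  rw [← Real.sqrt_eq_rpow]
  have hsN : Real.sqrt N * Real.sqrt N = N := Real.mul_self_sqrt (Nat.cast_nonneg N)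
  have h2ε : 2 / ε ≤ Real.sqrt N := by
    rw [show (2 / ε : ℝ) = Real.sqrt ((2 / ε) ^ 2) by rw [Real.sqrt_sq (by positivity)]]
    exact Real.sqrt_le_sqrt (by rw [div_pow]; norm_num; linarith)
  have h0 : 0 ≤ Real.sqrt N := Real.sqrt_nonneg _
  have h1 : Real.sqrt N ≤ ε / 2 * (Real.sqrt N * Real.sqrt N) := by
    have : (1 : ℝ) ≤ ε / 2 * Real.sqrt N := by
      have h := mul_le_mul_of_nonneg_left h2ε (by positivity : (0 : ℝ) ≤ ε / 2)
      rwa [show ε / 2 * (2 / ε) = (1 : ℝ) by field_simp] at h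
    nlinarith
  rwa [hsN] at h1

/-- **S1 = S1-D + S1-E** (`ε/2 + ε/2`): term `j ≥ 1` of the telescoping is `o(N)` given the atom `H_j`. -/
theorem termBound_of : ∀ (k : ℕ) (j : Fin (k + 1)), j ≠ 0 → ∀ η : ℝ, 0 < η →
    (∀ C A : ℝ, HybridOneMoebius (j : ℕ) η C A) → TermBound k j η := by
  intro k j hj η hη hH L δ hδ hstag hsum ε hε
  obtain ⟨N₁, hN₁⟩ := stub_termExpansion k j hj L δ hδ hsum
  obtain ⟨N₂, hN₂⟩ := stub_termClassSums k j hj η hη hH L δ hδ hstag hsum (ε / 2) (by positivity)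
  refine ⟨max (max N₁ N₂) ⌈4 / ε ^ 2⌉₊, fun N hN Ψ hΨ hsize K hK hKbox => ?_⟩
  have h1 := hN₁ N (le_trans (le_max_left _ _) (le_of_max_le_left hN)) Ψ hΨ hsize K hK hKbox
  have h2 := hN₂ N (le_trans (le_max_right _ _) (le_of_max_le_left hN)) Ψ hΨ hsize K hK hKbox
  have h3 : (N : ℝ) ^ (1 / 2 : ℝ) ≤ ε / 2 * N :=
    rpow_half_le_eps_mul hε ((Nat.le_ceil _).trans (by exact_mod_cast le_of_max_le_right hN))
  linarith

-- **S2 — LANDED** (p138577, `…Theorems.LeeYangFibresRelativeDimOneMoebiusSplitAssembly`):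
-- `stub_assembly : ∀ k, TruncatedMainTerm (k + 1) → MoebiusTermBound k →
--    (∀ j : Fin (k + 1), j ≠ 0 → ∃ η : ℝ, 0 < η ∧ TermBound k j η) → RelDimOneSlice (k + 1)`
-- (telescoping identity, geometric exponents `δ_i = (1/8) ρ^{-i}`, `ε/3` bookkeeping; imported, used by name).

/-- **H (THE ATOM, open problem).** The single-Möbius hybrid Hardy–Littlewood–Chowla schema for every
number `s ≥ 1` of prime factors, at SOME Möbius-dilation exponent `η > 0`, every prime-dilation
exponent `C` and every saving `A` — see `HybridOneMoebius`. -/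
theorem stub_hybrid : ∀ s : ℕ, 1 ≤ s → ∃ η : ℝ, 0 < η ∧ ∀ C A : ℝ, HybridOneMoebius s η C A := by
  sorry

/-! ## Composition (real proofs) -/

/-- **T1 = T1a + T1b**: the all-truncated sum carries the whole main term `β_∞𝔖` with Green–Tao's
error `ε(β_∞𝔖 + N)`, from the lattice count (error `εN/2`) and the singular-series asymptotic (error
`(ε/4)(𝔖 + 1)`, multiplied by `β_∞ ≤ 2N`, tree `archFactor_le_two_mul`). -/
theorem truncatedMainTerm_of {t : ℕ} (hA : TruncLatticeCount t) (hB : TruncSingularSeriesAsymp t) :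
    TruncatedMainTerm t := by
  intro L δ hδ hstag hsum ε hε
  obtain ⟨N₁, hN₁⟩ := hA L δ hδ hsum (ε / 2) (by positivity)
  obtain ⟨N₂, hN₂⟩ := hB L δ hδ hstag hsum (ε / 4) (by positivity)
  refine ⟨max N₁ N₂, fun N hN Ψ hΨ hsize K hK hKbox => ?_⟩
  have h1 := hN₁ N (le_of_max_le_left hN) Ψ hΨ hsize K hK hKbox
  have h2 := hN₂ N (le_of_max_le_right hN) Ψ hΨ hsize
  set T := truncCorrSum Ψ K N (fun i => (N : ℝ) ^ (δ i))
  set S := truncSingularSeries Ψ (fun i => (N : ℝ) ^ (δ i))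
  have hβ0 : 0 ≤ archFactor Ψ K := ENNReal.toReal_nonneg
  have hβ2 : archFactor Ψ K ≤ 2 * (N : ℝ) := archFactor_le_two_mul Ψ hKbox
  have h𝔖 : 0 ≤ singularProduct Ψ := singularProduct_nonneg' hΨ
  have hsplit : T - archFactor Ψ K * singularProduct Ψ =
      (T - archFactor Ψ K * S) + archFactor Ψ K * (S - singularProduct Ψ) := by ring
  rw [hsplit]
  calc |(T - archFactor Ψ K * S) + archFactor Ψ K * (S - singularProduct Ψ)|
      ≤ |T - archFactor Ψ K * S| + |archFactor Ψ K * (S - singularProduct Ψ)| := abs_add_le _ _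
    _ = |T - archFactor Ψ K * S| + archFactor Ψ K * |S - singularProduct Ψ| := by
        rw [abs_mul, abs_of_nonneg hβ0]
    _ ≤ ε / 2 * N + archFactor Ψ K * (ε / 4 * (singularProduct Ψ + 1)) :=
        add_le_add h1 (mul_le_mul_of_nonneg_left h2 hβ0)
    _ ≤ ε * (archFactor Ψ K * singularProduct Ψ + N) := by
        nlinarith [mul_nonneg hβ0 h𝔖, hε.le, mul_le_mul_of_nonneg_left hβ2 hε.le]

/-- **The skeleton's composition** — the crux modulo exactly the six registered stubs, used BY NAME
(first theorem of the file concluding the crux; audit: proof-of-item; not closed: `sorryAx` through the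
stubs only). Pure bookkeeping: `t = k + 1`, `stub_assembly k` fed with
T1 (`truncatedMainTerm_of` T1a T1b), T0', and S1 at the atom's `η_j` for each `1 ≤ j ≤ k`. -/
theorem relativeDimOne_modulo_stubs :
    Summit.Parity.GeneralizedHardyLittlewood.Theses.LeeYangFibres.RelativeDimOne := by
  intro t L ht ε hε
  obtain ⟨k, rfl⟩ : ∃ k, t = k + 1 := ⟨t - 1, by omega⟩
  revert L ε hε
  refine stub_assembly k (truncatedMainTerm_of (stub_truncLatticeCount k) (truncSingularSeries_of k))
    (stub_moebiusTermBV k) fun j hj => ?_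
  have hj1 : 1 ≤ (j : ℕ) := Nat.one_le_iff_ne_zero.mpr fun h => hj (Fin.ext h)
  obtain ⟨η, hη, hH⟩ := stub_hybrid (j : ℕ) hj1
  exact ⟨η, hη, termBound_of k j hj η hη hH⟩

/-- **The same composition in hypothesis form, kernel-checked with NO sorry in its cone**:
T1a → T1b → T0' → S1 → S2 → H → crux (by name). -/
theorem RelativeDimOne_of
    (hT1a : ∀ k : ℕ, TruncLatticeCount (k + 1))
    (hT1b : ∀ k : ℕ, TruncSingularSeriesAsymp (k + 1))
    (hT0 : ∀ k : ℕ, MoebiusTermBound k)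
    (hS1 : ∀ (k : ℕ) (j : Fin (k + 1)), j ≠ 0 → ∀ η : ℝ, 0 < η →
      (∀ C A : ℝ, HybridOneMoebius (j : ℕ) η C A) → TermBound k j η)
    (hS2 : ∀ k : ℕ, TruncatedMainTerm (k + 1) → MoebiusTermBound k →
      (∀ j : Fin (k + 1), j ≠ 0 → ∃ η : ℝ, 0 < η ∧ TermBound k j η) → RelDimOneSlice (k + 1))
    (hH : ∀ s : ℕ, 1 ≤ s → ∃ η : ℝ, 0 < η ∧ ∀ C A : ℝ, HybridOneMoebius s η C A) :
    Summit.Parity.GeneralizedHardyLittlewood.Theses.LeeYangFibres.RelativeDimOne := by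
  intro t L ht ε hε
  obtain ⟨k, rfl⟩ : ∃ k, t = k + 1 := ⟨t - 1, by omega⟩
  revert L ε hε
  refine hS2 k (truncatedMainTerm_of (hT1a k) (hT1b k)) (hT0 k) fun j hj => ?_
  have hj1 : 1 ≤ (j : ℕ) := Nat.one_le_iff_ne_zero.mpr fun h => hj (Fin.ext h)
  obtain ⟨η, hη, hHj⟩ := hH (j : ℕ) hj1
  exact ⟨η, hη, hS1 k j hj η hη hHj⟩

/-- Exponent vectors on `Fin 1` are trivially staggered (there is no later index). -/
theorem staggeredBy_fin_one (c : ℝ) (δ : Fin 1 → ℝ) (hδ : 0 ≤ δ 0) : StaggeredBy c δ := by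
  intro i
  have hi : i = 0 := Subsingleton.elim i 0
  subst hi
  have : Finset.Ioi (0 : Fin 1) = ∅ :=
    Finset.eq_empty_of_forall_notMem fun j hj => by
      have h := Finset.mem_Ioi.mp hj
      exact absurd (Subsingleton.elim (0 : Fin 1) j ▸ h) (lt_irrefl _)
  rw [this, Finset.sum_empty, mul_zero]
  exact hδ

/-- **The `k = 0` case of the assembly, PROVED** (the definitions compose as intended): for ONE form the
telescoping is `Λ = Λ_{R_0} + (Λ − Λ_{R_0})` exactly, so the `t = 1` slice of the crux follows from T1 at
`t = 1` and T0' at `k = 0` (levels `δ ≡ 1/8`) by the triangle inequality — no atom is consumed at `t = 1`. -/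
theorem slice_one_of_mainTerms (hT : TruncatedMainTerm 1) (hM : MoebiusTermBound 0) :
    RelDimOneSlice 1 := by
  intro L ε hε
  have hε2 : 0 < ε / 2 := by positivity
  obtain ⟨N₁, hN₁⟩ := hT L (fun _ => 1 / 8) (fun _ => by norm_num)
    (staggeredBy_fin_one 2 _ (by norm_num)) (by simp; norm_num) (ε / 2) hε2
  obtain ⟨N₂, hN₂⟩ := hM L (fun _ => 1 / 8) (fun _ => by norm_num) (by simp)
    (by simp; norm_num) (ε / 2) hε2
  refine ⟨max N₁ N₂, fun N hN Ψ hΨ hsize K hK hKbox => ?_⟩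
  have h1 := hN₁ N (le_of_max_le_left hN) Ψ hΨ hsize K hK hKbox
  have h2 := hN₂ N (le_of_max_le_right hN) Ψ hΨ hsize K hK hKbox
  have hid : vonMangoldtSum Ψ K N =
      truncCorrSum Ψ K N (fun _ => (N : ℝ) ^ (1 / 8 : ℝ)) +
        moebiusTermSum Ψ K N (fun _ => (N : ℝ) ^ (1 / 8 : ℝ)) := by
    unfold vonMangoldtSum truncCorrSum moebiusTermSum
    rw [← Finset.sum_add_distrib]
    refine Finset.sum_congr rfl fun n _ => ?_
    simp only [Fin.prod_univ_one, Finset.univ_eq_empty, Finset.prod_empty, mul_one]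
    ring
  have hM0 := mass_nonneg hΨ K
  rw [hid]
  calc |truncCorrSum Ψ K N (fun _ => (N : ℝ) ^ (1 / 8 : ℝ)) +
          moebiusTermSum Ψ K N (fun _ => (N : ℝ) ^ (1 / 8 : ℝ)) -
          archFactor Ψ K * singularProduct Ψ|
        = |(truncCorrSum Ψ K N (fun _ => (N : ℝ) ^ (1 / 8 : ℝ)) - archFactor Ψ K * singularProduct Ψ) +
            moebiusTermSum Ψ K N (fun _ => (N : ℝ) ^ (1 / 8 : ℝ))| := by ring_nf
    _ ≤ |truncCorrSum Ψ K N (fun _ => (N : ℝ) ^ (1 / 8 : ℝ)) - archFactor Ψ K * singularProduct Ψ| +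
          |moebiusTermSum Ψ K N (fun _ => (N : ℝ) ^ (1 / 8 : ℝ))| := abs_add_le _ _
    _ ≤ ε / 2 * (archFactor Ψ K * singularProduct Ψ + N) + ε / 2 * N := add_le_add h1 h2
    _ ≤ ε * (archFactor Ψ K * singularProduct Ψ + N) := by nlinarith [hM0, hε.le]

/-- Term `0` of the telescoping is the pure-Möbius term (sanity: `telescopeTermSum … 0 = moebiusTermSum`). -/
theorem telescopeTermSum_zero {k : ℕ} (Ψ : Fin (k + 1) → AffLinForm 1) (K : Set (Fin 1 → ℝ)) (N : ℕ)
    (R : Fin (k + 1) → ℝ) : telescopeTermSum Ψ K N R 0 = moebiusTermSum Ψ K N R := by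
  unfold telescopeTermSum moebiusTermSum
  refine Finset.sum_congr rfl fun n _ => ?_
  have h0 : Finset.Iio (0 : Fin (k + 1)) = ∅ := Finset.eq_empty_of_forall_notMem fun j hj => by
    have := Finset.mem_Iio.mp hj
    exact absurd this (Fin.not_lt_zero j)
  have hIoi : Finset.Ioi (0 : Fin (k + 1)) = (Finset.univ : Finset (Fin k)).map (Fin.succEmb k) := by
    ext j
    simp only [Finset.mem_Ioi, Finset.mem_map, Finset.mem_univ, true_and, Fin.coe_succEmb]
    constructor
    · intro hj
      exact ⟨j.pred (ne_of_gt hj), Fin.succ_pred _ _⟩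
    · rintro ⟨i, rfl⟩
      exact Fin.succ_pos i
  have h1 : ∏ i ∈ Finset.Ioi (0 : Fin (k + 1)), lambdaR (R i) ((Ψ i).eval n) =
      ∏ i : Fin k, lambdaR (R i.succ) ((Ψ i.succ).eval n) := by
    rw [hIoi, Finset.prod_map]
    simp only [Fin.coe_succEmb]
  rw [h0, Finset.prod_empty, one_mul, h1]

end Summit.Parity.GeneralizedHardyLittlewood.Cruxes.RelativeDimOne.SingleMoebiusSplit
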